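import Mathlib
import Summits.Ventures.FusionMHD.Models.CerfonFreidbergIterLikeQHalfObligation
import HarnessLib

/-!
# Ventures/FusionMHD — Models/CerfonFreidbergIterLikeQHalfPanels5.lean: KERNEL CHECK of panels 19, 20, 21, 22 (of 32) of the
# certified interior safety factor `q(ψ_N = 1/2)/F` of THE Cerfon–Freidberg ITER-like instance

HONEST FRAMING (LADDER-GRIDFUSION three columns; CF rung, F2 item R2).  One `decide +kernel` (≈ 120 s on the farm): for each panel `j` listed,
the per-panel obligation `QHalf.PanelCert.ok` (`Models/CerfonFreidbergIterLikeQHalfObligation.lean`) — the Taylor-model run of `QHalf.progG`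
(`Models/CerfonFreidbergIterLikeQHalfDefs.lean`) over the parameter box is ACCEPTED (every `log`/`sin`/`cos` composition and the `inv`
certificate), and the kernel's panel-integral enclosure of the polar `(6.35)` integrand along the approximant, the range of the flux residual
`U(ray m) − U_a/2`, the range of the approximant `m` and the range of the radial derivative `D_r(θ, m)` lie inside the integers claimed in
`panelCert5` (values read off a compiled `#eval` of the same functions, slack one unit of `2⁻⁶⁰`).  What these Booleans MEAN (real-number
statements, uniformly over the parameter box ∋ THE instance) is proved once in `Models/CerfonFreidbergIterLikeQHalfSound.lean`; the
assembly is `Models/CerfonFreidbergIterLikeQHalf.lean`.  MODELLED: analytic Cerfon–Freidberg family; `q` of a MODEL surface — nothing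
about a device or stability.  No `native_decide`.  Typer/prover: gridfusion-model-5 (g7), 2026-08-27.
Citations: Freidberg 2014 §6.3.5 (6.35) [Freidberg2014]; Mahboubi–Melquiond–Sibut-Pinote 2016 §3.2 Lemma 3 [MahboubiMelquiondSibutpinote2016].
-/

namespace Summit.Ventures.FusionMHD.Models.CFIterLike.QHalf

/-- The certificate data of panels 19, 20, 21, 22: `inv` candidate (degree-8 fit of `(X·D_r)⁻¹` in the panel variable, scaled by `2⁶⁰`), Taylor
degree, `inv` widening `2^elog2`, and the claimed integral / residual / `m`-range / `D_r`-range integers (× `2⁶⁰`). [instance data] -/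
def panelCert5 : List PanelCert := [
  { j := 19, cand := [14894776335085910016, 24354933365073956864, -307011853123714875392, -769735568446051713024, 12450804595205209063424, 29112257650359749574656, -548779848311191363387392, -1093515326015328669925376, 24668829345933682406326272],
    deg := 10, elog2 := 37, plo := 537264228683239475, phi := 537264239830498278, eta := 135064846, mlo := 420229576760494059, mhi := 429155020406781216,
    dlo := 95593492552543096, dhi := 98126520541511550 },
  { j := 20, cand := [15344782502492528640, 4470795566416377856, -305229264203843502080, 740173517930166616064, 9392368083204732616704, -56734616706307600678912, -207996583391514010320896, 2956146870169801781673984, -484458969653907248119808],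
    deg := 10, elog2 := 38, plo := 539803380125916461, phi := 539803400936116856, eta := 133360428, mlo := 406137490800151523, mhi := 421956758660155167,
    dlo := 95689329326154936, dhi := 98558551638260753 },
  { j := 21, cand := [15216164357965287424, -11580140480281628672, -199334299762960793600, 1324827251031819681792, 292428170980209721344, -45995820713881058148352, 223167189041155514826752, 535214590734572560842752, -10812102913012978195365888],
    deg := 10, elog2 := 37, plo := 514301460748890636, phi := 514301471255852665, eta := 127478702, mlo := 387772957686194343, mhi := 407082435035062850,
    dlo := 97909033911735074, dhi := 103321450889432857 },
  { j := 22, cand := [14699175395772051456, -20299745523461459968, -84179027747344629760, 1050791553630116249600, -3640741548864821002240, -7017412271503555166208, 148625687897444752293888, -707196813629494317285376, -44076844102949013553152],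
    deg := 10, elog2 := 37, plo := 473093631764486802, phi := 473093641704533833, eta := 118255262, mlo := 368149018656617281, mhi := 388001361937837823,
    dlo := 102923919801749999, dhi := 109826274386451483 }]

/-- **KERNEL CHECK** of panels 19, 20, 21, 22. -/
theorem panelCert5_ok : panelCert5.all PanelCert.ok = true := by
  decide +kernel

end Summit.Ventures.FusionMHD.Models.CFIterLike.QHalf
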